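import Literature.Computability.AlgebraicComplexity.NestFreeMatchingFifo
import Literature.Combinatorics.Enumerative.BallotSequences
import HarnessLib

/-!
# Nonnesting perfect matchings of `[2n]` are counted by the Catalan numbers

Topic `Combinatorics/Enumerative`; proved theorems only (no definitions, no named facts).

**The statement, as printed.** Chen–Deng–Du–Stanley–Yan 2007, §1: "A (complete) matching on
`[2n] = {1, 2, …, 2n}` is a partition of `[2n]` of type `(2, 2, …, 2)`. … Two blocks (also called
arcs) `(i_r, j_r)` and `(i_s, j_s)` form a crossing if `i_r < i_s < j_r < j_s`; they form a nesting if
`i_r < i_s < j_s < j_r`. It is well-known that the number of matchings on `[2n]` with no crossings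
(or with no nestings) is given by the `n`-th Catalan number"; Stanley EC2, Exercise 6.19 (ww):
nonnesting matchings of `[2n]` are one of the Catalan families ("the blocks of the matching are the
columns of the standard Young tableaux of shape `(n, n)`", i.e. the `k`-th smallest left endpoint is
matched with the `k`-th smallest right endpoint). The tree states the objects
(`Literature.Computability.AlgebraicComplexity.nestFreeMatchings m`, the nest-free fixed-point-free
involutions `M : Fin m → Fin m`, file `NestFreeMatchingPoly.lean`) and proves one half of the
classical bijection with ballot sequences (`NestFreeMatchingFifo.lean`: the FIFO pairing `fifo w h`
of a ballot word `w` is a nest-free perfect matching, `fifo_mem_nestFreeMatchings`), announcing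
the converse and the count as "NOT here". THIS FILE PROVES THE CONVERSE AND THE COUNT.

## Contents (all on the tree's objects; nothing is redefined)

* `card_filter_lt_orderEmbOfFin` — the counting form of "the `k`-th smallest element":
  exactly `k` elements of `s` lie below `s.orderEmbOfFin h k`.
* Structure of a nest-free perfect matching `M` (`apply_lt_apply_of_lt_of_mem_nestFreeMatchings`:
  `M` is increasing on openers and on closers; `apply_orderEmbOfFin_openerSet`: **the `k`-th
  opener is matched with the `k`-th closer**), whence
  ★ `eq_fifo_of_mem_nestFreeMatchings` — **every nest-free perfect matching is the FIFO pairing of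
  its opener word**, `isBallot_of_mem_nestFreeMatchings` (that word is a ballot word), and the
  characterisation `mem_nestFreeMatchings_iff_exists_fifo` (`M` is nest-free iff `M = fifo w h` for a
  ballot word `w`); ★ `nestFreeMatchings_injOn_openers` — a nest-free matching is determined by its
  set of openers.
* The prefix-count form of the ballot condition: `le_two_mul_card_openers_lt` (in ANY perfect
  matching every prefix `[0, t)` contains at least as many openers as closers — closers are matched
  to earlier openers), `openers_mem_ballotSets`; and conversely `isBallot_of_prefix_count` (a word
  with the prefix-count property has its `k`-th opener before its `k`-th closer).
* ★★ `image_openers_nestFreeMatchings : (nestFreeMatchings (2n)).image openers = ballotSets n`,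
  ★★★ `card_nestFreeMatchings_two_mul : #nestFreeMatchings (2n) = catalan n` (CDDSY 2007 §1 /
  EC2 6.19 (ww), through the tree's `card_ballotSets : #ballotSets n = catalan n` =
  Mathlib's `DyckWord.card_dyckWord_semilength_eq_catalan`), `nestFreeMatchings_odd` /
  `card_nestFreeMatchings` (no perfect matching of an odd number of points; the general formula
  `if Even m then catalan (m / 2) else 0`), and the corollary for the route polynomial
  `card_support_nestFreeMatchingPoly_eq_catalan : #support NN_n = catalan n`.

## Not here

The noncrossing twin `#noncrossingMatchings (2n) = catalan n` (the tree has the count for the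
percolation lineage's `NCMatching` / `LinkPattern` encodings: `card_ncMatching_two_mul`); the joint
symmetry of the statistics `cr`, `ne` (CDDSY 2007, Thm 1.1).

## References

* W. Y. C. Chen, E. Y. P. Deng, R. R. X. Du, R. P. Stanley, C. H. Yan, *Crossings and nestings of
  matchings and partitions*, Trans. AMS 359 (2007) 1555–1575, §1. [ChenDengDuStanleyYan2007]
* R. P. Stanley, *Enumerative Combinatorics* vol. 2 (1999), Exercise 6.19 (ww). [Stanley1999EC2]
* M. Aigner, *A Course in Enumeration* (2007), §3.1 Exercise 3.9 (ballot lists). [Aigner2007]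
-/

open Finset
open Literature.Computability.AlgebraicComplexity

namespace Literature.Combinatorics.Enumerative

/-! ### The `k`-th smallest element of a finset, counting form -/

section KthElement

variable {α : Type*} [LinearOrder α]

/-- The elements of `s` below its `k`-th smallest element `s.orderEmbOfFin h k` are the images of
the indices below `k`. [cite: Stanley1999EC2, Exercise 6.19 (ww), API: the k-th smallest element] -/
theorem filter_lt_orderEmbOfFin_eq_map (s : Finset α) {n : ℕ} (h : s.card = n) (k : Fin n) :
    (s.filter fun x => x < s.orderEmbOfFin h k) = (Iio k).map (s.orderEmbOfFin h).toEmbedding := by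
  ext x
  simp only [mem_filter, mem_map, mem_Iio, RelEmbedding.coe_toEmbedding]
  constructor
  · rintro ⟨hx, hlt⟩
    obtain ⟨j, rfl⟩ : x ∈ Set.range (s.orderEmbOfFin h) := by
      rw [range_orderEmbOfFin]; exact mem_coe.2 hx
    exact ⟨j, (s.orderEmbOfFin h).lt_iff_lt.1 hlt, rfl⟩
  · rintro ⟨j, hj, rfl⟩
    exact ⟨orderEmbOfFin_mem _ _ _, (s.orderEmbOfFin h).lt_iff_lt.2 hj⟩

/-- **Exactly `k` elements of `s` lie below its `k`-th smallest element** (`k` counted from `0`).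
[cite: Stanley1999EC2, Exercise 6.19 (ww), API: the k-th smallest element] -/
theorem card_filter_lt_orderEmbOfFin (s : Finset α) {n : ℕ} (h : s.card = n) (k : Fin n) :
    (s.filter fun x => x < s.orderEmbOfFin h k).card = k := by
  rw [filter_lt_orderEmbOfFin_eq_map, card_map, Fin.card_Iio]

end KthElement

/-! ### Openers and closers of a perfect matching -/

section Matchings

variable {m : ℕ} {M : Fin m → Fin m}

/-- In a perfect matching a point that is not an opener is a closer: `¬ i < M i ↔ M i < i`.
[cite: ChenDengDuStanleyYan2007, §1 (matchings as fixed-point-free involutions), API] -/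
theorem not_lt_apply_iff_of_mem_perfectMatchings (hM : M ∈ perfectMatchings m) (i : Fin m) :
    ¬ i < M i ↔ M i < i := by
  obtain ⟨-, hfp⟩ := mem_perfectMatchings.1 hM
  exact ⟨fun h => lt_of_le_of_ne (not_lt.1 h) (hfp i), fun h => not_lt.2 h.le⟩

/-- The partner of an opener is a closer and conversely: `M i < M (M i) ↔ M i < i`, i.e.
`M i` is an opener iff `i` is a closer.
[cite: ChenDengDuStanleyYan2007, §1 (arcs (i_r, j_r), i_r < j_r), API] -/
theorem apply_lt_apply_apply_iff (hM : M ∈ perfectMatchings m) (i : Fin m) :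
    M i < M (M i) ↔ M i < i := by
  rw [(mem_perfectMatchings.1 hM).1 i]

/-- A perfect matching has as many closers as openers (`M` is a bijection from the openers onto
the closers). [cite: ChenDengDuStanleyYan2007, §1 (a matching of [2n] has n arcs), API] -/
theorem card_closers_eq_card_openers (hM : M ∈ perfectMatchings m) :
    (univ.filter fun i => M i < i).card = (openers M).card := by
  rw [← image_openers hM,
    card_image_of_injective _ (Function.Involutive.injective (mem_perfectMatchings.1 hM).1)]

/-- **In a perfect matching every prefix contains at least as many openers as closers**: for
`t ≤ m`, `t ≤ 2 · #{openers < t}` (each closer below `t` is matched to an opener below it).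
This is the prefix condition of ballot sequences for the opener word.
[cite: Aigner2007, §3.1 Exercise 3.9 (ballot condition); ChenDengDuStanleyYan2007, §1] -/
theorem le_two_mul_card_openers_lt (hM : M ∈ perfectMatchings m) (t : ℕ) (ht : t ≤ m) :
    t ≤ 2 * ((openers M).filter fun i : Fin m => (i : ℕ) < t).card := by
  obtain ⟨hinv, hfp⟩ := mem_perfectMatchings.1 hM
  -- the closers below `t` are matched injectively into the openers below `t`
  have hcl : ((univ.filter fun i => M i < i).filter fun i : Fin m => (i : ℕ) < t).card ≤
      ((openers M).filter fun i : Fin m => (i : ℕ) < t).card := by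
    refine Finset.card_le_card_of_injOn M (fun i hi => ?_) ?_
    · simp only [coe_filter, mem_filter, mem_univ, true_and, Set.mem_setOf_eq, mem_openers] at hi ⊢
      refine ⟨by rw [hinv]; exact hi.1, lt_trans (Fin.lt_def.1 hi.1) hi.2⟩
    · exact (Function.Involutive.injective hinv).injOn
  -- the positions below `t` split into openers and closers
  have hsplit : ((univ : Finset (Fin m)).filter fun i : Fin m => (i : ℕ) < t) =
      ((openers M).filter fun i : Fin m => (i : ℕ) < t) ∪
        ((univ.filter fun i => M i < i).filter fun i : Fin m => (i : ℕ) < t) := by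
    ext i
    simp only [mem_filter, mem_univ, true_and, mem_union, mem_openers]
    constructor
    · intro hi
      by_cases h : i < M i
      · exact Or.inl ⟨h, hi⟩
      · exact Or.inr ⟨(not_lt_apply_iff_of_mem_perfectMatchings hM i).1 h, hi⟩
    · rintro (⟨-, hi⟩ | ⟨-, hi⟩) <;> exact hi
  have hdisj : Disjoint ((openers M).filter fun i : Fin m => (i : ℕ) < t)
      ((univ.filter fun i => M i < i).filter fun i : Fin m => (i : ℕ) < t) := by
    rw [Finset.disjoint_left]
    intro i h1 h2
    simp only [mem_filter, mem_univ, true_and, mem_openers] at h1 h2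
    exact lt_asymm h1.1 h2.1
  have hcard : ((univ : Finset (Fin m)).filter fun i : Fin m => (i : ℕ) < t).card = t := by
    rw [Fin.card_filter_val_lt, min_eq_right ht]
  rw [hsplit, card_union_of_disjoint hdisj] at hcard
  omega

/-- **The openers of a perfect matching of `[2n]` form a ballot set** (`n` openers, and the prefix
condition). [cite: ChenDengDuStanleyYan2007, §1] -/
theorem openers_mem_ballotSets {n : ℕ} {M : Fin (2 * n) → Fin (2 * n)}
    (hM : M ∈ perfectMatchings (2 * n)) : openers M ∈ ballotSets n :=
  mem_ballotSets.2 ⟨card_openers hM, fun t ht => le_two_mul_card_openers_lt hM t ht⟩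

/-- A perfect matching of an odd number of points does not exist.
[cite: ChenDengDuStanleyYan2007, §1 (matchings of [2n]), API] -/
theorem perfectMatchings_odd (n : ℕ) : perfectMatchings (2 * n + 1) = ∅ := by
  refine eq_empty_of_forall_notMem fun M hM => ?_
  have := two_mul_card_openers hM
  omega

/-- There is no nest-free perfect matching of an odd number of points.
[cite: ChenDengDuStanleyYan2007, §1 (matchings of [2n]), API] -/
theorem nestFreeMatchings_odd (n : ℕ) : nestFreeMatchings (2 * n + 1) = ∅ :=
  subset_empty.1 ((nestFreeMatchings_subset_perfectMatchings).trans (perfectMatchings_odd n).subset)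

end Matchings

/-! ### The structure of a nest-free perfect matching: openers and closers are paired in order -/

section NestFree

variable {m : ℕ} {M : Fin m → Fin m}

/-- **In a nest-free perfect matching a later opener closes later**: if `i < j` are openers then
`M i < M j` (otherwise `i < j < M j < M i` would be a nesting). [cite: ChenDengDuStanleyYan2007, §1] -/
theorem apply_lt_apply_of_lt_of_mem_nestFreeMatchings (hM : M ∈ nestFreeMatchings m) {i j : Fin m}
    (hi : i < M i) (hj : j < M j) (hij : i < j) : M i < M j := by
  obtain ⟨hP, hnest⟩ := mem_nestFreeMatchings.1 hM
  obtain ⟨hinv, -⟩ := mem_perfectMatchings.1 hP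
  rcases lt_trichotomy (M i) (M j) with h | h | h
  · exact h
  · exact absurd (Function.Involutive.injective hinv h) (ne_of_lt hij)
  · exact absurd hi (fun _ => hnest i j hij hj h)

/-- In a nest-free perfect matching a later closer was opened later: if `i < j` are closers then
`M i < M j`. [cite: ChenDengDuStanleyYan2007, §1] -/
theorem apply_lt_apply_of_lt_of_closers (hM : M ∈ nestFreeMatchings m) {i j : Fin m}
    (hi : M i < i) (hj : M j < j) (hij : i < j) : M i < M j := by
  obtain ⟨hP, -⟩ := mem_nestFreeMatchings.1 hM
  obtain ⟨hinv, -⟩ := mem_perfectMatchings.1 hP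
  rcases lt_trichotomy (M i) (M j) with h | h | h
  · exact h
  · exact absurd (Function.Involutive.injective hinv h) (ne_of_lt hij)
  · -- `M j < M i` are openers, so `j = M (M j) < M (M i) = i`
    have := apply_lt_apply_of_lt_of_mem_nestFreeMatchings hM
      ((apply_lt_apply_apply_iff hP j).2 hj) ((apply_lt_apply_apply_iff hP i).2 hi) h
    rw [hinv, hinv] at this
    exact absurd hij (lt_asymm this)

variable {w : Fin m → Bool}

/-- If `w` is the opener word of `M` (`w i = true ↔ i < M i`) then `openerSet w = openers M`.
[cite: ChenDengDuStanleyYan2007, §1, API] -/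
theorem openerSet_eq_openers (hw : ∀ i, w i = true ↔ i < M i) : openerSet w = openers M := by
  ext i
  rw [mem_openerSet, mem_openers, hw]

/-- If `w` is the opener word of a perfect matching `M` then `closerSet w` is the set of closers
`{i | M i < i}`. [cite: ChenDengDuStanleyYan2007, §1, API] -/
theorem closerSet_eq_filter (hM : M ∈ perfectMatchings m) (hw : ∀ i, w i = true ↔ i < M i) :
    closerSet w = univ.filter fun i => M i < i := by
  ext i
  rw [mem_closerSet, mem_filter, ← not_lt_apply_iff_of_mem_perfectMatchings hM, ← hw,
    Bool.eq_false_iff]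
  exact (and_iff_right (mem_univ _)).symm

/-- The opener word of a perfect matching has as many closers as openers. [cite: ChenDengDuStanleyYan2007, §1, API] -/
theorem card_closerSet_eq_of_openerWord (hM : M ∈ perfectMatchings m)
    (hw : ∀ i, w i = true ↔ i < M i) : (closerSet w).card = (openerSet w).card := by
  rw [closerSet_eq_filter hM hw, openerSet_eq_openers hw, card_closers_eq_card_openers hM]

/-- ★ **In a nest-free perfect matching the `k`-th opener is matched with the `k`-th closer**
(Stanley EC2 6.19 (ww): the arcs are the columns of a `2 × n` standard Young tableau).
[cite: Stanley1999EC2, Exercise 6.19 (ww)] -/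
theorem apply_orderEmbOfFin_openerSet (hM : M ∈ nestFreeMatchings m)
    (hw : ∀ i, w i = true ↔ i < M i) (h : (closerSet w).card = (openerSet w).card)
    (k : Fin (openerSet w).card) :
    M ((openerSet w).orderEmbOfFin rfl k) = (closerSet w).orderEmbOfFin h k := by
  obtain ⟨hP, -⟩ := mem_nestFreeMatchings.1 hM
  have hop : ∀ a : Fin (openerSet w).card, (openerSet w).orderEmbOfFin rfl a <
      M ((openerSet w).orderEmbOfFin rfl a) := fun a =>
    (hw _).1 (mem_openerSet.1 (orderEmbOfFin_mem _ _ a))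
  have hmono : StrictMono fun a : Fin (openerSet w).card => M ((openerSet w).orderEmbOfFin rfl a) :=
    fun a b hab => apply_lt_apply_of_lt_of_mem_nestFreeMatchings hM (hop a) (hop b)
      (((openerSet w).orderEmbOfFin rfl).lt_iff_lt.2 hab)
  have hmem : ∀ a : Fin (openerSet w).card,
      M ((openerSet w).orderEmbOfFin rfl a) ∈ closerSet w := fun a => by
    rw [closerSet_eq_filter hP hw, mem_filter]
    exact ⟨mem_univ _, (apply_lt_apply_apply_iff hP _).1 (by
      rw [(mem_perfectMatchings.1 hP).1]; exact hop a)⟩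
  exact congrFun (orderEmbOfFin_unique h hmem hmono) k

/-- ★★ **Every nest-free perfect matching is the FIFO pairing of its opener word** — the converse
of the tree's `fifo_mem_nestFreeMatchings`. [cite: ChenDengDuStanleyYan2007, §1] -/
theorem eq_fifo_of_mem_nestFreeMatchings (hM : M ∈ nestFreeMatchings m)
    (hw : ∀ i, w i = true ↔ i < M i) (h : (closerSet w).card = (openerSet w).card) :
    M = fifo w h := by
  obtain ⟨hP, -⟩ := mem_nestFreeMatchings.1 hM
  obtain ⟨hinv, -⟩ := mem_perfectMatchings.1 hP
  funext i
  by_cases hi : w i = true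
  · obtain ⟨k, rfl⟩ := exists_eq_opener hi
    rw [fifo_opener, apply_orderEmbOfFin_openerSet hM hw h k]
  · obtain ⟨k, rfl⟩ := exists_eq_closer h (Bool.eq_false_iff.2 hi)
    rw [fifo_closer, ← apply_orderEmbOfFin_openerSet hM hw h k, hinv]

/-- The opener word of a nest-free perfect matching is a ballot word: its `k`-th opener precedes
its `k`-th closer (which is the partner of the `k`-th opener). [cite: ChenDengDuStanleyYan2007, §1] -/
theorem isBallot_of_mem_nestFreeMatchings (hM : M ∈ nestFreeMatchings m)
    (hw : ∀ i, w i = true ↔ i < M i) (h : (closerSet w).card = (openerSet w).card) :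
    IsBallot w h := fun k => by
  rw [← apply_orderEmbOfFin_openerSet hM hw h k]
  exact (hw _).1 (mem_openerSet.1 (orderEmbOfFin_mem _ _ k))

/-- ★★ **Nest-free perfect matchings = FIFO pairings of ballot words**: `M` is a nest-free perfect
matching of `Fin m` iff `M = fifo w h` for a ballot word `w` (then necessarily its opener word).
[cite: ChenDengDuStanleyYan2007, §1] -/
theorem mem_nestFreeMatchings_iff_exists_fifo :
    M ∈ nestFreeMatchings m ↔ ∃ (w : Fin m → Bool) (h : (closerSet w).card = (openerSet w).card),
      IsBallot w h ∧ M = fifo w h := by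
  constructor
  · intro hM
    obtain ⟨hP, -⟩ := mem_nestFreeMatchings.1 hM
    have hw : ∀ i, (fun i => decide (i < M i)) i = true ↔ i < M i := fun i => decide_eq_true_iff
    exact ⟨fun i => decide (i < M i), card_closerSet_eq_of_openerWord hP hw,
      isBallot_of_mem_nestFreeMatchings hM hw _, eq_fifo_of_mem_nestFreeMatchings hM hw _⟩
  · rintro ⟨w, h, hb, rfl⟩
    exact fifo_mem_nestFreeMatchings hb

/-- ★ **A nest-free perfect matching is determined by its set of openers.**
[cite: Stanley1999EC2, Exercise 6.19 (ww)] -/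
theorem nestFreeMatchings_injOn_openers :
    Set.InjOn (openers : (Fin m → Fin m) → Finset (Fin m)) ↑(nestFreeMatchings m) := by
  intro M hM M' hM' hMM'
  have hw : ∀ i, (fun i => decide (i ∈ openers M)) i = true ↔ i < M i := fun i => by
    rw [decide_eq_true_iff, mem_openers]
  have hw' : ∀ i, (fun i => decide (i ∈ openers M)) i = true ↔ i < M' i := fun i => by
    rw [decide_eq_true_iff]
    exact (Finset.ext_iff.1 hMM' i).trans mem_openers
  have h := card_closerSet_eq_of_openerWord (nestFreeMatchings_subset_perfectMatchings hM) hw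
  rw [eq_fifo_of_mem_nestFreeMatchings (mem_coe.1 hM) hw h,
    eq_fifo_of_mem_nestFreeMatchings (mem_coe.1 hM') hw' h]

end NestFree

/-! ### Ballot words: the prefix-count condition gives the order condition -/

section Ballot

variable {m : ℕ} {w : Fin m → Bool}

/-- Every position is an opener or a closer of the word, exclusively: the positions below `c`
split accordingly. [cite: Aigner2007, §3.1 Exercise 3.9, API] -/
theorem card_filter_lt_eq_add (w : Fin m → Bool) (c : Fin m) :
    (c : ℕ) = ((openerSet w).filter fun x => x < c).card + ((closerSet w).filter fun x => x < c).card := by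
  have hsplit : (Iio c) = ((openerSet w).filter fun x => x < c) ∪ ((closerSet w).filter fun x => x < c) := by
    ext x
    simp only [mem_Iio, mem_union, mem_filter, mem_openerSet, mem_closerSet]
    cases w x <;> simp
  have hdisj : Disjoint ((openerSet w).filter fun x => x < c) ((closerSet w).filter fun x => x < c) := by
    rw [Finset.disjoint_left]
    intro x h1 h2
    simp only [mem_filter, mem_openerSet, mem_closerSet] at h1 h2
    rw [h1.1] at h2
    exact Bool.noConfusion h2.1
  rw [← card_union_of_disjoint hdisj, ← hsplit, Fin.card_Iio]

/-- ★ **The prefix-count ballot condition implies the order condition**: if every prefix `[0, t)`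
(`t ≤ m`) contains at least as many openers as closers (`t ≤ 2 · #{openers < t}`), then the `k`-th
opener precedes the `k`-th closer for every `k` (`IsBallot`). [cite: Aigner2007, §3.1 Exercise 3.9] -/
theorem isBallot_of_prefix_count (h : (closerSet w).card = (openerSet w).card)
    (hcount : ∀ t ≤ m, t ≤ 2 * ((openerSet w).filter fun i : Fin m => (i : ℕ) < t).card) :
    IsBallot w h := by
  intro k
  by_contra hk
  rw [not_lt] at hk
  set c := (closerSet w).orderEmbOfFin h k with hc
  -- exactly `k` closers lie below the `k`-th closer `c`
  have h1 : ((closerSet w).filter fun x => x < c).card = k := card_filter_lt_orderEmbOfFin _ h k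
  -- at most `k` openers lie below `c ≤ k`-th opener
  have h2 : ((openerSet w).filter fun x => x < c).card ≤ k := by
    calc ((openerSet w).filter fun x => x < c).card
        ≤ ((openerSet w).filter fun x => x < (openerSet w).orderEmbOfFin rfl k).card :=
          card_le_card fun x hx => by
            rw [mem_filter] at hx ⊢
            exact ⟨hx.1, lt_of_lt_of_le hx.2 hk⟩
      _ = k := card_filter_lt_orderEmbOfFin _ rfl k
  have h3 := card_filter_lt_eq_add w c
  -- `c` is a closer, so the openers below `c + 1` are the openers below `c`
  have hc' : w c = false := mem_closerSet.1 (orderEmbOfFin_mem _ _ k)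
  have h4 : ((openerSet w).filter fun i : Fin m => (i : ℕ) < c + 1) =
      ((openerSet w).filter fun x => x < c) := by
    ext x
    simp only [mem_filter, mem_openerSet, Fin.lt_def, and_congr_right_iff]
    intro hx
    constructor
    · intro hlt
      refine lt_of_le_of_ne (Nat.le_of_lt_succ hlt) fun heq => ?_
      rw [Fin.ext heq, hc'] at hx
      exact Bool.noConfusion hx
    · exact fun hlt => Nat.lt_succ_of_lt hlt
  have h5 := hcount (c + 1) (by have := c.isLt; omega)
  rw [h4] at h5
  omega

/-- Conversely, **the order condition implies the prefix-count condition**: if the `k`-th opener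
precedes the `k`-th closer for every `k`, then `t ≤ 2 · #{openers < t}` for every `t ≤ m`.
[cite: Aigner2007, §3.1 Exercise 3.9] -/
theorem prefix_count_of_isBallot {h : (closerSet w).card = (openerSet w).card} (hb : IsBallot w h)
    (t : ℕ) (ht : t ≤ m) :
    t ≤ 2 * ((openerSet w).filter fun i : Fin m => (i : ℕ) < t).card :=
  le_two_mul_card_openers_lt (nestFreeMatchings_subset_perfectMatchings (fifo_mem_nestFreeMatchings hb))
    t ht |>.trans (by rw [← openerSet_eq_openers (fun i => (mem_openers_fifo_iff hb i).symm.trans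
      (by rw [mem_openers]))])

end Ballot

/-! ### The bijection with ballot sets and the Catalan count -/

section Count

variable {n : ℕ}

/-- The indicator word of a set `S` of positions has opener set `S`. [cite: Aigner2007, §3.1 Exercise 3.9, API] -/
theorem openerSet_indicator {m : ℕ} (S : Finset (Fin m)) :
    openerSet (fun i => decide (i ∈ S)) = S := by
  ext i
  rw [mem_openerSet, decide_eq_true_iff]

/-- The indicator word of a set `S` of positions has closer set `Sᶜ`. [cite: Aigner2007, §3.1 Exercise 3.9, API] -/
theorem closerSet_indicator {m : ℕ} (S : Finset (Fin m)) :
    closerSet (fun i => decide (i ∈ S)) = Sᶜ := by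
  ext i
  rw [mem_closerSet, mem_compl, decide_eq_false_iff_not]

/-- A ballot set of order `n` and its complement in `Fin (2n)` both have `n` elements, so its
indicator word has as many closers as openers. [cite: Aigner2007, §3.1 Exercise 3.9, API] -/
theorem card_closerSet_indicator_of_mem_ballotSets {S : Finset (Fin (2 * n))} (hS : S ∈ ballotSets n) :
    (closerSet (fun i => decide (i ∈ S))).card = (openerSet (fun i => decide (i ∈ S))).card := by
  rw [closerSet_indicator, openerSet_indicator, card_compl, Fintype.card_fin, (mem_ballotSets.1 hS).1]
  omega

/-- The indicator word of a ballot set is a ballot word (order form). [cite: Aigner2007, §3.1 Exercise 3.9] -/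
theorem isBallot_indicator_of_mem_ballotSets {S : Finset (Fin (2 * n))} (hS : S ∈ ballotSets n) :
    IsBallot (fun i => decide (i ∈ S)) (card_closerSet_indicator_of_mem_ballotSets hS) :=
  isBallot_of_prefix_count _ fun t ht => by
    rw [openerSet_indicator]; exact (mem_ballotSets.1 hS).2 t ht

/-- **Every ballot set is the opener set of a nest-free perfect matching** (namely of the FIFO
pairing of its indicator word). [cite: ChenDengDuStanleyYan2007, §1] -/
theorem exists_mem_nestFreeMatchings_openers_eq {S : Finset (Fin (2 * n))} (hS : S ∈ ballotSets n) :
    ∃ M ∈ nestFreeMatchings (2 * n), openers M = S :=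
  ⟨fifo _ (card_closerSet_indicator_of_mem_ballotSets hS),
    fifo_mem_nestFreeMatchings (isBallot_indicator_of_mem_ballotSets hS), by
      ext i
      rw [mem_openers_fifo_iff (isBallot_indicator_of_mem_ballotSets hS), decide_eq_true_iff]⟩

/-- ★★ **Nonnesting matchings ↔ ballot sequences**: taking opener sets maps the nest-free perfect
matchings of `[2n]` ONTO the ballot sets of order `n` (and injectively,
`nestFreeMatchings_injOn_openers`). [cite: Stanley1999EC2, Exercise 6.19 (ww)] -/
theorem image_openers_nestFreeMatchings (n : ℕ) :
    (nestFreeMatchings (2 * n)).image openers = ballotSets n := by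
  ext S
  rw [mem_image]
  constructor
  · rintro ⟨M, hM, rfl⟩
    exact openers_mem_ballotSets (nestFreeMatchings_subset_perfectMatchings hM)
  · intro hS
    obtain ⟨M, hM, hMS⟩ := exists_mem_nestFreeMatchings_openers_eq hS
    exact ⟨M, hM, hMS⟩

/-- The opener-set map is a bijection from the nest-free perfect matchings of `[2n]` onto the
ballot sets of order `n`. [cite: Stanley1999EC2, Exercise 6.19 (ww)] -/
theorem bijOn_openers_nestFreeMatchings (n : ℕ) :
    Set.BijOn (openers : (Fin (2 * n) → Fin (2 * n)) → Finset (Fin (2 * n)))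
      ↑(nestFreeMatchings (2 * n)) ↑(ballotSets n) := by
  refine ⟨fun M hM => ?_, nestFreeMatchings_injOn_openers, fun S hS => ?_⟩
  · exact mem_coe.2 (openers_mem_ballotSets (nestFreeMatchings_subset_perfectMatchings (mem_coe.1 hM)))
  · obtain ⟨M, hM, hMS⟩ := exists_mem_nestFreeMatchings_openers_eq (mem_coe.1 hS)
    exact ⟨M, mem_coe.2 hM, hMS⟩

/-- The number of nest-free perfect matchings of `[2n]` is the number of ballot sets of order `n`.
[cite: Stanley1999EC2, Exercise 6.19 (ww)] -/
theorem card_nestFreeMatchings_eq_card_ballotSets (n : ℕ) :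
    (nestFreeMatchings (2 * n)).card = (ballotSets n).card := by
  rw [← image_openers_nestFreeMatchings n, card_image_of_injOn nestFreeMatchings_injOn_openers]

/-- ★★★ **The number of nonnesting (complete) matchings of `[2n]` is the Catalan number `C_n`.**
[cite: ChenDengDuStanleyYan2007, §1] -/
theorem card_nestFreeMatchings_two_mul (n : ℕ) : (nestFreeMatchings (2 * n)).card = catalan n := by
  rw [card_nestFreeMatchings_eq_card_ballotSets, card_ballotSets]

/-- The number of nest-free perfect matchings of `[2n]` is the number of Dyck words of semilength
`n`. [cite: Stanley1999EC2, Exercise 6.19 (ww)] -/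
theorem card_nestFreeMatchings_eq_card_dyckWord (n : ℕ) :
    (nestFreeMatchings (2 * n)).card = Fintype.card {p : DyckWord // p.semilength = n} := by
  rw [card_nestFreeMatchings_two_mul, DyckWord.card_dyckWord_semilength_eq_catalan]

/-- The count for every number of points: `catalan (m / 2)` nest-free perfect matchings of `Fin m`
for `m` even, none for `m` odd. [cite: ChenDengDuStanleyYan2007, §1] -/
theorem card_nestFreeMatchings (m : ℕ) :
    (nestFreeMatchings m).card = if m % 2 = 0 then catalan (m / 2) else 0 := by
  rcases Nat.even_or_odd m with ⟨n, rfl⟩ | ⟨n, rfl⟩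
  · rw [if_pos (by omega), ← two_mul, card_nestFreeMatchings_two_mul, Nat.mul_div_cancel_left _ two_pos]
  · rw [if_neg (by omega), nestFreeMatchings_odd, card_empty]

/-- Sanity values: `1, 1, 2, 5, 14` nest-free perfect matchings of `0, 2, 4, 6, 8` points.
[cite: ChenDengDuStanleyYan2007, §1] -/
theorem card_nestFreeMatchings_values :
    (List.range 5).map (fun n => (nestFreeMatchings (2 * n)).card) = [1, 1, 2, 5, 14] := by
  simp only [List.map, List.range, List.range.loop, card_nestFreeMatchings_two_mul, catalan_zero,
    catalan_one, catalan_two, catalan_three]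
  refine List.cons_eq_cons.2 ⟨rfl, List.cons_eq_cons.2 ⟨rfl, List.cons_eq_cons.2 ⟨rfl,
    List.cons_eq_cons.2 ⟨rfl, List.cons_eq_cons.2 ⟨?_, rfl⟩⟩⟩⟩⟩
  rw [catalan_succ', Nat.sum_antidiagonal_eq_sum_range_succ (fun i j => catalan i * catalan j)]
  simp [Finset.sum_range_succ, catalan_two, catalan_three]

/-- **`NN_n` has `C_n` monomials**: the route polynomial `nestFreeMatchingPoly n k` (the sum of the
arc monomials of the nest-free perfect matchings of `[2n]`) has exactly `catalan n` monomials in its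
support, over any nontrivial coefficient semiring. [cite: ChenDengDuStanleyYan2007, §1] -/
theorem card_support_nestFreeMatchingPoly_eq_catalan (n : ℕ) (k : Type*) [CommSemiring k]
    [Nontrivial k] : (nestFreeMatchingPoly n k).support.card = catalan n := by
  rw [card_support_nestFreeMatchingPoly, card_nestFreeMatchings_two_mul]

end Count

end Literature.Combinatorics.Enumerative
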